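/-
Copyright: internal research formalization. Source text: G. Kempf, Instability in invariant theory,
Ann. of Math. 108 (1978), §2–§4 (the flag / parabolic subgroup `P(λ)` of a one-parameter subgroup
and its stability under the stabiliser, Cor. 4.4–4.5), specialised to `SL_σ` and weight vectors.
-/
import Mathlib
import HarnessLib

/-!
# The coordinate flag of a weight vector pulled back by a matrix

For a matrix `h` over a field `K` indexed by a finite type `σ`, a real weight vector `a : σ → ℝ`
and a threshold `r : ℝ`, the **weight flag**
`F(h, a, r) = {x | ∀ i, a i < r → (h x)_i = 0}` — the pull-back by `h` of the coordinate subspace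
spanned by the `e_j` with `a j ≥ r` — written WITHOUT a new definition as
`(Submodule.pi {i | a i < r} (fun _ => ⊥)).comap h.mulVecLin`. These are the steps of the flag of
the parabolic subgroup `P(a) = {p : p i j = 0 whenever a i < a j}` of the one-parameter subgroup
`t ↦ h⁻¹ diag(t^a) h` (Kempf 1978 §2; Mumford, GIT Ch. 2 §2).

## Contents (theorem-only)

* `mem_weightFlag_iff` — unfolding.
* `weightFlag_mul` — `F(h γ, a, r) = γ⁻¹ F(h, a, r)` (as a `comap`).
* `mulVec_mem_weightFlag_of_eq` — **stability**: if `F(h γ, a, r) = F(h, a, r)` then `γ` maps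
  `F(h, a, r)` into itself (Kempf Cor. 4.4: the stabiliser of `v` preserves the canonical flag, once
  the flags of all optimal pairs `(h, a)` and `(h γ, a)` are known to coincide).
* `weightFlag_ne_bot`, `weightFlag_ne_top` — for `h` invertible the flag step is nonzero as soon as
  some `a j ≥ r` and proper as soon as some `a i < r`;
  `exists_weightFlag_ne_bot_ne_top` — a non-constant weight has a proper nonzero flag step, in
  particular (`exists_weightFlag_ne_bot_ne_top_of_sum_eq_zero`) a nonzero weight with `∑ a = 0`.
* `weightFlag_parabolic_mul` — every invertible `p ∈ P(a)` (i.e.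
  `p.BlockTriangular (toDual ∘ a)`) satisfies `F(p h, a, r) = F(h, a, r)`: the flag only depends on
  the coset `P(a) h`.

Consumer: the Kempf optimal-parabolic programme for `SL_σ` (cell `val-lit`, file E
`KempfOptimalParabolicSL.lean`): target «`¬ IsPolystable v ⇒ ∃ W ≠ ⊥, ≠ ⊤, stable under
`SL ∩ Stab v`»». Honest framing: linear algebra; nothing here bears on any open problem.

## References

* [Kempf1978] G. R. Kempf, Ann. of Math. (2) 108 (1978), §2, Cor. 4.4–4.5.
* [MumfordFogartyKirwan1994] D. Mumford, J. Fogarty, F. Kirwan, GIT, 3rd ed., Ch. 2 §2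
  (the flag and parabolic of a one-parameter subgroup).
-/

open Matrix

namespace Literature.LinearAlgebra.Matrix

section WeightFlag

variable {K : Type*} [Field K] {σ : Type*} [Fintype σ] [DecidableEq σ]

omit [DecidableEq σ] in
/-- Unfolding the weight flag: `x ∈ F(h, a, r) ↔ ∀ i, a i < r → (h x)_i = 0`.
[cite: Kempf1978, §2] -/
theorem mem_weightFlag_iff (h : Matrix σ σ K) (a : σ → ℝ) (r : ℝ) (x : σ → K) :
    x ∈ (Submodule.pi {i : σ | a i < r} (fun _ => (⊥ : Submodule K K))).comap h.mulVecLin ↔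
      ∀ i, a i < r → h.mulVec x i = 0 := by
  simp [Submodule.mem_pi]

omit [DecidableEq σ] in
/-- `F(h γ, a, r)` is the pull-back of `F(h, a, r)` by `γ`. [cite: Kempf1978, §2] -/
theorem weightFlag_mul (h γ : Matrix σ σ K) (a : σ → ℝ) (r : ℝ) :
    (Submodule.pi {i : σ | a i < r} (fun _ => (⊥ : Submodule K K))).comap (h * γ).mulVecLin =
      ((Submodule.pi {i : σ | a i < r} (fun _ => (⊥ : Submodule K K))).comap h.mulVecLin).comap
        γ.mulVecLin := by
  rw [Matrix.mulVecLin_mul, Submodule.comap_comp]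

omit [DecidableEq σ] in
/-- **Stability of the flag** (Kempf 1978, Cor. 4.4, last step): if the flags of `(h γ, a)` and
`(h, a)` coincide then `γ` maps `F(h, a, r)` into itself. [cite: Kempf1978, Cor. 4.4] -/
theorem mulVec_mem_weightFlag_of_eq {h γ : Matrix σ σ K} {a : σ → ℝ} {r : ℝ}
    (heq : (Submodule.pi {i : σ | a i < r} (fun _ => (⊥ : Submodule K K))).comap (h * γ).mulVecLin =
      (Submodule.pi {i : σ | a i < r} (fun _ => (⊥ : Submodule K K))).comap h.mulVecLin)
    {x : σ → K}
    (hx : x ∈ (Submodule.pi {i : σ | a i < r} (fun _ => (⊥ : Submodule K K))).comap h.mulVecLin) :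
    γ.mulVec x ∈ (Submodule.pi {i : σ | a i < r} (fun _ => (⊥ : Submodule K K))).comap h.mulVecLin := by
  rw [← heq, weightFlag_mul] at hx
  exact hx

/-- Left multiplication by an element of the parabolic `P(a)` (`p i j = 0` whenever `a i < a j`)
does not change the flag: `F(p h, a, r) = F(h, a, r)` for `p` invertible in `P(a)`.
[cite: Kempf1978, §2] -/
theorem weightFlag_parabolic_mul {p h : Matrix σ σ K} {a : σ → ℝ} (r : ℝ)
    (hp : p.BlockTriangular (OrderDual.toDual ∘ a)) (hpdet : IsUnit p.det) :
    (Submodule.pi {i : σ | a i < r} (fun _ => (⊥ : Submodule K K))).comap (p * h).mulVecLin =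
      (Submodule.pi {i : σ | a i < r} (fun _ => (⊥ : Submodule K K))).comap h.mulVecLin := by
  -- the coordinate subspace `{y | ∀ i, a i < r → y i = 0}` is stable under `p` and `p⁻¹`
  have key : ∀ (q : Matrix σ σ K), q.BlockTriangular (OrderDual.toDual ∘ a) →
      ∀ y : σ → K, (∀ i, a i < r → y i = 0) → ∀ i, a i < r → q.mulVec y i = 0 := by
    intro q hq y hy i hi
    rw [Matrix.mulVec, dotProduct]
    refine Finset.sum_eq_zero fun j _ => ?_
    by_cases hj : a j < r
    · rw [hy j hj, mul_zero]
    · have hij : a i < a j := lt_of_lt_of_le hi (not_lt.mp hj)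
      rw [hq (show (OrderDual.toDual ∘ a) j < (OrderDual.toDual ∘ a) i from hij), zero_mul]
  letI : Invertible p := Matrix.invertibleOfIsUnitDet p hpdet
  have hinv : (p⁻¹).BlockTriangular (OrderDual.toDual ∘ a) :=
    Matrix.blockTriangular_inv_of_blockTriangular hp
  ext x
  simp only [Submodule.mem_comap, Matrix.mulVecLin_apply, Submodule.mem_pi, Set.mem_setOf_eq,
    Submodule.mem_bot]
  rw [← Matrix.mulVec_mulVec]
  constructor
  · intro hx i hi
    have := key p⁻¹ hinv _ hx i hi
    rwa [Matrix.mulVec_mulVec, Matrix.nonsing_inv_mul p hpdet, Matrix.one_mulVec] at this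
  · intro hx
    exact key p hp _ hx

/-- The flag step is NONZERO when `h` is invertible and some weight is `≥ r`.
[cite: Kempf1978, §2] -/
theorem weightFlag_ne_bot {h : Matrix σ σ K} (hh : IsUnit h.det) {a : σ → ℝ} {r : ℝ} {j : σ}
    (hj : r ≤ a j) :
    (Submodule.pi {i : σ | a i < r} (fun _ => (⊥ : Submodule K K))).comap h.mulVecLin ≠ ⊥ := by
  rw [Submodule.ne_bot_iff]
  refine ⟨h⁻¹.mulVec (Pi.single j 1), ?_, ?_⟩
  · rw [mem_weightFlag_iff]
    intro i hi
    rw [Matrix.mulVec_mulVec, Matrix.mul_nonsing_inv h hh, Matrix.one_mulVec, Pi.single_apply,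
      if_neg]
    rintro rfl
    exact absurd hj (not_le.mpr hi)
  · intro h0
    have : h.mulVec (h⁻¹.mulVec (Pi.single j (1 : K))) = 0 := by rw [h0, Matrix.mulVec_zero]
    rw [Matrix.mulVec_mulVec, Matrix.mul_nonsing_inv h hh, Matrix.one_mulVec] at this
    have hj' := congrFun this j
    simp at hj'

/-- The flag step is PROPER when some weight is `< r`. [cite: Kempf1978, §2] -/
theorem weightFlag_ne_top {h : Matrix σ σ K} (hh : IsUnit h.det) {a : σ → ℝ} {r : ℝ} {i : σ}
    (hi : a i < r) :
    (Submodule.pi {i : σ | a i < r} (fun _ => (⊥ : Submodule K K))).comap h.mulVecLin ≠ ⊤ := by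
  intro htop
  have hx : h⁻¹.mulVec (Pi.single i 1) ∈
      (Submodule.pi {i : σ | a i < r} (fun _ => (⊥ : Submodule K K))).comap h.mulVecLin := by
    rw [htop]; exact Submodule.mem_top
  rw [mem_weightFlag_iff] at hx
  have := hx i hi
  rw [Matrix.mulVec_mulVec, Matrix.mul_nonsing_inv h hh, Matrix.one_mulVec] at this
  simp at this

/-- **A non-constant weight has a proper nonzero flag step** (threshold = any value strictly
between two distinct weights, e.g. the larger one): for `h` invertible and `a i₀ < a j₀` the step
at `r = a j₀` is `≠ ⊥` and `≠ ⊤`. [cite: Kempf1978, §2] -/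
theorem exists_weightFlag_ne_bot_ne_top {h : Matrix σ σ K} (hh : IsUnit h.det) {a : σ → ℝ}
    {i₀ j₀ : σ} (hij : a i₀ < a j₀) :
    ∃ r : ℝ, (Submodule.pi {i : σ | a i < r} (fun _ => (⊥ : Submodule K K))).comap h.mulVecLin ≠ ⊥ ∧
      (Submodule.pi {i : σ | a i < r} (fun _ => (⊥ : Submodule K K))).comap h.mulVecLin ≠ ⊤ :=
  ⟨a j₀, weightFlag_ne_bot hh le_rfl, weightFlag_ne_top hh hij⟩

/-- A nonzero weight with `∑ a = 0` is non-constant, so it has a proper nonzero flag step.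
[cite: Kempf1978, §2] -/
theorem exists_weightFlag_ne_bot_ne_top_of_sum_eq_zero {h : Matrix σ σ K} (hh : IsUnit h.det)
    {a : σ → ℝ} (ha : a ≠ 0) (hsum : ∑ i, a i = 0) :
    ∃ r : ℝ, (Submodule.pi {i : σ | a i < r} (fun _ => (⊥ : Submodule K K))).comap h.mulVecLin ≠ ⊥ ∧
      (Submodule.pi {i : σ | a i < r} (fun _ => (⊥ : Submodule K K))).comap h.mulVecLin ≠ ⊤ := by
  -- some weight is positive and some is negative... precisely: there are `i₀, j₀` with `a i₀ < a j₀`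
  obtain ⟨k, hk⟩ : ∃ k, a k ≠ 0 := by
    by_contra hcon
    push Not at hcon
    exact ha (funext hcon)
  rcases lt_or_gt_of_ne hk with hneg | hpos
  · -- `a k < 0`: some `a j > a k` since the sum is `0`
    obtain ⟨j, hj⟩ : ∃ j, a k < a j := by
      by_contra hcon
      push Not at hcon
      have : ∑ i, a i ≤ ∑ _i : σ, a k := Finset.sum_le_sum fun i _ => hcon i
      rw [hsum, Finset.sum_const, Finset.card_univ, nsmul_eq_mul] at this
      have hcard : (0 : ℝ) < Fintype.card σ := by
        exact_mod_cast Fintype.card_pos_iff.mpr ⟨k⟩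
      nlinarith
    exact exists_weightFlag_ne_bot_ne_top hh hj
  · obtain ⟨j, hj⟩ : ∃ j, a j < a k := by
      by_contra hcon
      push Not at hcon
      have : ∑ _i : σ, a k ≤ ∑ i, a i := Finset.sum_le_sum fun i _ => hcon i
      rw [hsum, Finset.sum_const, Finset.card_univ, nsmul_eq_mul] at this
      have hcard : (0 : ℝ) < Fintype.card σ := by
        exact_mod_cast Fintype.card_pos_iff.mpr ⟨k⟩
      nlinarith
    exact exists_weightFlag_ne_bot_ne_top hh hj

omit [Fintype σ] [DecidableEq σ] in
/-- The two phrasings of the parabolic `P(a)`: `BlockTriangular (toDual ∘ a)` (entries vanish when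
`a i < a j`) iff `q i j ≠ 0 → a j ≤ a i` (the form used with weight bounds on monomials).
[cite: Kempf1978, §2] -/
theorem blockTriangular_toDual_comp_iff (q : Matrix σ σ K) (a : σ → ℝ) :
    q.BlockTriangular (OrderDual.toDual ∘ a) ↔ ∀ i j, q i j ≠ 0 → a j ≤ a i := by
  constructor
  · intro hq i j hij
    by_contra hlt
    exact hij (hq (show (OrderDual.toDual ∘ a) j < (OrderDual.toDual ∘ a) i from not_le.mp hlt))
  · intro hq i j hij
    by_contra hne
    exact absurd (hq i j hne) (not_le.mpr hij)

/-! ### Signed permutation matrices move the flag to the permuted weight -/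

/-- Entries of a signed permutation matrix `ŵ = π.toPEquiv.toMatrix * diagonal ε`:
`ŵ i j = ε j` if `j = π i`, else `0`. [cite: Kempf1978, §2] -/
theorem signedPerm_apply (π : Equiv.Perm σ) (ε : σ → K) (i j : σ) :
    (π.toPEquiv.toMatrix * diagonal ε : Matrix σ σ K) i j = if j = π i then ε j else 0 := by
  rw [Matrix.mul_apply]
  simp only [PEquiv.toMatrix_apply, Equiv.toPEquiv_apply, Option.mem_def, Option.some.injEq,
    diagonal_apply]
  rw [Finset.sum_eq_single (π i)]
  · by_cases h : j = π i
    · subst h; simp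
    · simp [h, Ne.symm h]
  · intro b _ hb
    simp [Ne.symm hb]
  · intro h; exact absurd (Finset.mem_univ _) h

/-- A signed permutation matrix acts on vectors by `(ŵ y) i = ε (π i) · y (π i)`.
[cite: Kempf1978, §2] -/
theorem signedPerm_mulVec (π : Equiv.Perm σ) (ε : σ → K) (y : σ → K) (i : σ) :
    (π.toPEquiv.toMatrix * diagonal ε : Matrix σ σ K).mulVec y i = ε (π i) * y (π i) := by
  simp only [Matrix.mulVec, dotProduct, signedPerm_apply]
  rw [Finset.sum_eq_single (π i)]
  · simp
  · intro b _ hb; simp [hb]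
  · intro h; exact absurd (Finset.mem_univ _) h

/-- **Weyl covariance of the flag**: for a signed permutation matrix
`ŵ = π.toPEquiv.toMatrix * diagonal ε` with all `ε j ≠ 0`, `F(ŵ h, a, r) = F(h, a ∘ π⁻¹, r)`.
(Kempf 1978 §2: the Weyl group permutes the weights of one-parameter subgroups.)
[cite: Kempf1978, §2] -/
theorem weightFlag_signedPerm_mul (π : Equiv.Perm σ) {ε : σ → K} (hε : ∀ j, ε j ≠ 0)
    (h : Matrix σ σ K) (a : σ → ℝ) (r : ℝ) :
    (Submodule.pi {i : σ | a i < r} (fun _ => (⊥ : Submodule K K))).comap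
        ((π.toPEquiv.toMatrix * diagonal ε : Matrix σ σ K) * h).mulVecLin =
      (Submodule.pi {i : σ | (a ∘ π.symm) i < r} (fun _ => (⊥ : Submodule K K))).comap
        h.mulVecLin := by
  ext x
  rw [mem_weightFlag_iff, mem_weightFlag_iff]
  simp only [← Matrix.mulVec_mulVec, signedPerm_mulVec, Function.comp_apply, mul_eq_zero]
  constructor
  · intro hx i hi
    have := hx (π.symm i) (by simpa using hi)
    rcases this with h0 | h0
    · exact absurd h0 (hε _)
    · simpa using h0
  · intro hx i hi
    exact Or.inr (hx (π i) (by simpa using hi))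

end WeightFlag

end Literature.LinearAlgebra.Matrix
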